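import Literature.Topology.FourManifolds.TrisectionsMidSectorBand
import Literature.Topology.FourManifolds.TrisectionsMidSectorColumnModel
import Literature.Topology.FourManifolds.TrisectionsSectorTwoHandles
import Literature.Topology.FourManifolds.HCobordismTradeStep
import HarnessLib

/-!
# A boundary-adapted function on the middle sector `X₂` (Gay–Kirby 2016, Lemma 14), III:
# the handle columns — `ψ₂` has exactly the centres of the `2`-handles as critical points there

Topic `Literature/Topology/FourManifolds`; infrastructure for the fact seat
`provefact-Literature.Topology.FourManifolds.exists_isBalancedGKTrisection` (Gay–Kirby 2016,
Thm. 4 via §4, Lemma 14).  Everything in this file is **proved**; no named facts are introduced.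

For the function `ψ₂ = 1 - C Ψ₂` of `TrisectionsMidSectorFunction.lean` on the middle sector
`X₂` over a tube frame `𝔉` with parameters `𝔔 : 𝔉.MidParams`, consider the **handle column**
`col_j = {A_j < 2a_R, a - δ_U < f < c} ∩ source_j` of the `j`-th `2`-handle (an open set
containing the centre `c_j` and the chart zone).  There (`MidParams.PsiTwo_eq_colFn_of_mem_col`)

  `Ψ₂ = G ∘ coord_j`,  `G(u) = s (T₀ - s) w(k_g 𝒯̂(u)) R₀(A)`  (`TrisectionsMidSectorColumnModel.lean`)

— the plateau `M̃ = f - c` (thin tubes), `-V = s` (above the bevel), `W = w(k_g 𝒯̂_j)` (on the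
zone by definition, on the shell because the lifted Heegaard function is `k_g 𝒯 = k_g 𝒯̂`
there) and `R = R₀(A_j)`.  By the model computation and the transfer of Morse data through
Milnor's chart (`MilnorBox.isMCriticalPt_comp_coord_iff`, `MilnorBox.morseData_comp_coord`):

* `MidParams.eq_cpt_of_isMCriticalPt_psiTwo_of_mem_col` — **the only critical point of `ψ₂`
  on the column is the centre `c_j`**;
* `MidParams.morseData_psiTwo_cpt` — **`c_j` is a nondegenerate critical point of `ψ₂` of
  index `0`** (the `2`-handle contributes one `0`-handle of `X₂`: Gay–Kirby's "the `2`-handles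
  cancel `g - k` of the `S¹ × B³`'s").

## References

* D. Gay, R. Kirby, *Trisecting 4-manifolds*, Geom. Topol. 20 (2016), §4, Lemma 14. [GayKirby2016]
* J. Milnor, *Lectures on the h-cobordism theorem* (1965), Def. 3.1, Thm. 3.12. [MilnorHCobordism1965]
* J. Milnor, *Morse theory* (1963), §2. [Milnor1963]
-/

open scoped Manifold ContDiff Topology
open Set Function Filter

noncomputable section

universe u

namespace Literature.Topology.FourManifolds

open Flow

variable {X : Type u} [TopologicalSpace X] [T2Space X] [CompactSpace X]
  [ChartedSpace (EuclideanSpace ℝ (Fin 4)) X] [IsManifold (𝓡 4) ∞ X]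

namespace BiCollar

namespace TriData

namespace TubeFrame

namespace MidParams

variable {B : BiCollar X} {T : B.TriData} {ι : Type} [Fintype ι] {𝔉 : T.TubeFrame ι} (𝔔 : 𝔉.MidParams) {j : ι}

/-! ### The handle columns -/

/-- **The handle column** of the `j`-th box: `{A_j < 2a_R, a - δ_U < f < c} ∩ source_j`. [cite: GayKirby2016, §4, Lemma 14] -/
def col (j : ι) : Set X :=
  {y | y ∈ (𝔉.boxes.box j).chart.source ∧ 𝔉.boxes.A j y < 2 * 𝔔.aR ∧ B.a - B.U.δ < B.f y ∧ B.f y < T.c}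

omit [T2Space X] [CompactSpace X] in
/-- Membership in the column. [folklore] -/
theorem mem_col {y : X} : y ∈ 𝔔.col j ↔
    y ∈ (𝔉.boxes.box j).chart.source ∧ 𝔉.boxes.A j y < 2 * 𝔔.aR ∧ B.a - B.U.δ < B.f y ∧ B.f y < T.c := Iff.rfl

omit [T2Space X] [CompactSpace X] in
/-- The columns are open. [folklore] -/
theorem isOpen_col (j : ι) : IsOpen (𝔔.col j) := by
  have h1 : IsOpen {y | y ∈ (𝔉.boxes.box j).chart.source ∧ 𝔉.boxes.A j y < 2 * 𝔔.aR} :=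
    (𝔉.boxes.continuousOn_A j).isOpen_inter_preimage (𝔉.boxes.box j).chart.open_source isOpen_Iio
  have h2 : IsOpen (B.f ⁻¹' Ioo (B.a - B.U.δ) T.c) := isOpen_Ioo.preimage B.U.contMDiff_f.continuous
  have : 𝔔.col j = {y | y ∈ (𝔉.boxes.box j).chart.source ∧ 𝔉.boxes.A j y < 2 * 𝔔.aR} ∩ B.f ⁻¹' Ioo (B.a - B.U.δ) T.c := by
    ext y; simp only [col, mem_setOf_eq, mem_inter_iff, mem_preimage, mem_Ioo]; tauto
  rw [this]; exact h1.inter h2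

omit [T2Space X] [CompactSpace X] in
/-- The column lies in the thin tube: `P_j < P₀` (indeed `B_j < ν² + A_j`). [folklore] -/
theorem P_lt_of_mem_col {y : X} (hy : y ∈ 𝔔.col j) : 𝔉.boxes.P j y < 𝔉.P₀ := by
  obtain ⟨hsrc, hA, -, hfc⟩ := hy
  have hA0 := 𝔉.boxes.A_nonneg j y
  have hB0 := 𝔉.boxes.B_nonneg j y
  have hB : 𝔉.boxes.B j y < 𝔉.ν ^ 2 + 𝔉.boxes.A j y := by
    have h := 𝔉.boxes.apply_eq hsrc
    rw [𝔉.c_eq] at hfc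
    linarith
  rw [HandleBoxes.P_def]
  calc 𝔉.boxes.A j y * 𝔉.boxes.B j y ≤ 𝔉.boxes.A j y * (𝔉.ν ^ 2 + 𝔉.boxes.A j y) :=
        mul_le_mul_of_nonneg_left hB.le hA0
    _ < 2 * 𝔔.aR * (𝔉.ν ^ 2 + 2 * 𝔔.aR) := by nlinarith [𝔉.ν_pos, 𝔔.aR_pos]
    _ ≤ 𝔉.P₀ := 𝔔.col_P

omit [T2Space X] [CompactSpace X] in
/-- On the column, `s > δ_U` (`s = η₂ - A + B ≥ η₂ - 2a_R > δ_U`). [folklore] -/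
theorem lt_sFun_of_mem_col {y : X} (hy : y ∈ 𝔔.col j) : B.U.δ < B.sFun y := by
  obtain ⟨hsrc, hA, -, -⟩ := hy
  have h := 𝔉.boxes.apply_eq hsrc
  have hB0 := 𝔉.boxes.B_nonneg j y
  have := 𝔔.band_aR
  show B.U.δ < B.f y - B.a
  linarith

omit [T2Space X] [CompactSpace X] in
/-- Heights on the column: `a - η₂ < f < a + 2η₂`. [folklore] -/
theorem f_bounds_of_mem_col {y : X} (hy : y ∈ 𝔔.col j) : B.a - 𝔉.η₂ < B.f y ∧ B.f y < B.a + 2 * 𝔉.η₂ := by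
  obtain ⟨-, -, hf₁, hfc⟩ := hy
  exact ⟨by linarith [𝔉.band_le], hfc.trans 𝔉.c_lt⟩

/-- **On the column, `-V = s`** (the bevel is supported in `|s| < rOut₁ < δ_U`). [folklore] -/
theorem neg_faceV_of_mem_col {y : X} (hy : y ∈ 𝔔.col j) : -T.D.faceV y = B.sFun y := by
  have hs := 𝔔.lt_sFun_of_mem_col hy
  rw [T.D.faceV_eq_neg_sFun_of_le (by rw [abs_of_pos (B.U.δ_pos.trans hs)]; linarith [T.D.rOut₁_lt]), neg_neg]

/-- **On the column, `M̃ = f - c`** (plateau of the rounding on the thin tubes). [cite: GayKirby2016, §4, Lemma 14] -/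
theorem Mt_of_mem_col {y : X} (hy : y ∈ 𝔔.col j) : T.Mt y = B.f y - T.c :=
  (𝔉.Mt_eventuallyEq_sub_of_P_lt 𝔔.plateau hy.1 (𝔔.P_lt_of_mem_col hy) hy.2.2.1
    (𝔔.f_bounds_of_mem_col hy).2).self_of_nhds

/-- On the column, `F₁ = s > 0`: the column misses `X₁`, the bevel face and the surface. [folklore] -/
theorem F₁_pos_of_mem_col {y : X} (hy : y ∈ 𝔔.col j) : 0 < T.D.F₁ y := by
  have hs := 𝔔.lt_sFun_of_mem_col hy
  have hθ : T.D.θ y = 0 := T.D.θ_eq_zero_of_le (by rw [abs_of_pos (B.U.δ_pos.trans hs)]; linarith [T.D.rOut₁_lt])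
  show 0 < B.sFun y + T.D.κ * T.D.θ y
  rw [hθ, mul_zero, add_zero]
  exact B.U.δ_pos.trans hs

/-- On the column, `M̃ < 0`. [folklore] -/
theorem Mt_neg_of_mem_col {y : X} (hy : y ∈ 𝔔.col j) : T.Mt y < 0 := by
  rw [𝔔.Mt_of_mem_col hy]; linarith [hy.2.2.2]

/-- A point of the column with `A_j > 0` hits the level. [cite: MilnorHCobordism1965, Thm. 3.13] -/
theorem hit_of_mem_col_of_A_pos {y : X} (hy : y ∈ 𝔔.col j) (hA : 0 < 𝔉.boxes.A j y) : B.Hit y := by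
  obtain ⟨hf₁, hf₂⟩ := 𝔔.f_bounds_of_mem_col hy
  by_contra hh
  obtain ⟨i, hi, hA0⟩ := 𝔉.exists_A_eq_zero_of_not_hit hf₁ hf₂ hh
  by_cases hij : i = j
  · subst hij; rw [hA0] at hA; exact lt_irrefl _ hA
  · exact (𝔉.boxes.disjoint hij).le_bot ⟨hi, hy.1⟩

/-- **On the column, `W = w(k_g 𝒯̂(coord_j))`**: on the zone `{A_j < a_R}` by definition of the
weight, on the shell `{a_R ≤ A_j < 2a_R}` because the point hits, lies in no zone, and the lifted
Heegaard function there is `k_g 𝒯(coord_j) = k_g 𝒯̂(coord_j)` (`ρ(A) = 1/A`). [cite: GayKirby2016, §4, Lemma 14] -/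
theorem W_of_mem_col {y : X} (hy : y ∈ 𝔔.col j) :
    𝔔.W y = 𝔔.w (𝔉.kg * TubeModel.tubeHat 𝔉.εT 𝔉.κT 𝔉.η₂ 𝔔.ρ ((𝔉.boxes.box j).coord y)) := by
  unfold W
  by_cases hzone : 𝔉.boxes.A j y < 𝔔.aR
  · rw [𝔉.boxes.weight_of_mem_zone ⟨hy.1, hzone⟩]; rfl
  · push Not at hzone
    have hall : ∀ i, y ∉ 𝔉.boxes.zone 𝔔.aR i := by
      intro i hi
      by_cases hij : i = j
      · subst hij; exact absurd hi.2 (not_lt.2 hzone)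
      · exact (𝔉.boxes.disjoint hij).le_bot ⟨hi.1, hy.1⟩
    rw [𝔉.boxes.weight_of_forall_not_mem hall]
    have hApos : 0 < 𝔉.boxes.A j y := 𝔔.aR_pos.trans_le hzone
    have hh : B.Hit y := 𝔔.hit_of_mem_col_of_A_pos hy hApos
    obtain ⟨hf₁, hf₂⟩ := 𝔔.f_bounds_of_mem_col hy
    rw [𝔉.flowLift_eq_gFun_add hh, 𝔉.gFun_eq_of_P_lt hy.1 (𝔔.P_lt_of_mem_col hy) hf₁ hf₂ hh, 𝔔.g₀_eq]
    have hρ : 𝔔.ρ (𝔉.boxes.A j y) = (𝔉.boxes.A j y)⁻¹ := 𝔔.ρ_eq_inv _ (by linarith)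
    rw [← 𝔉.boxes.tubeHat_eq_tube (ε := 𝔉.εT) (κ := 𝔉.κT) hρ]
    unfold HandleBoxes.tubeHat
    ring_nf

omit [T2Space X] [CompactSpace X] in
/-- On `source_j`, `R = R₀(A_j)`. [folklore] -/
theorem Rad_of_mem_source {y : X} (hy : y ∈ (𝔉.boxes.box j).chart.source) : 𝔔.Rad y = 𝔔.R₀ (𝔉.boxes.A j y) := by
  unfold Rad; exact 𝔉.boxes.radial_of_mem_source hy

/-- **On the column, `Ψ₂ = G ∘ coord_j`** with `G` the column function of
`TrisectionsMidSectorColumnModel.lean` (`T₀ = c - a`). [cite: GayKirby2016, §4, Lemma 14] -/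
theorem PsiTwo_eq_colFn_of_mem_col {y : X} (hy : y ∈ 𝔔.col j) :
    𝔔.PsiTwo y = TubeColumn.colFn 𝔔.w 𝔔.ρ 𝔔.R₀ 𝔉.kg 𝔉.εT 𝔉.κT 𝔉.η₂ (T.c - B.a) ((𝔉.boxes.box j).coord y) := by
  rw [PsiTwo, 𝔔.neg_faceV_of_mem_col hy, 𝔔.Mt_of_mem_col hy, 𝔔.W_of_mem_col hy, 𝔔.Rad_of_mem_source hy.1,
    TubeColumn.colFn_apply, ← 𝔉.boxes.sub_eq_sM hy.1, 𝔉.boxes.A_eq_nsq]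
  simp only [BiCollar.sFun]
  ring

/-- The model function `G₁ = 1 - C G` of the column. [folklore] -/
def colG (𝔔 : 𝔉.MidParams) (u : EuclideanSpace ℝ (Fin 4)) : ℝ :=
  1 - 𝔔.C * TubeColumn.colFn 𝔔.w 𝔔.ρ 𝔔.R₀ 𝔉.kg 𝔉.εT 𝔉.κT 𝔉.η₂ (T.c - B.a) u

/-- **On the column, `ψ₂ = G₁ ∘ coord_j` near every point.** [cite: GayKirby2016, §4, Lemma 14] -/
theorem psiTwo_eventuallyEq_of_mem_col {y : X} (hy : y ∈ 𝔔.col j) :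
    𝔔.psiTwo =ᶠ[𝓝 y] 𝔔.colG ∘ (𝔉.boxes.box j).coord := by
  filter_upwards [(𝔔.isOpen_col j).mem_nhds hy] with z hz
  simp only [comp_apply, colG, psiTwo, 𝔔.PsiTwo_eq_colFn_of_mem_col hz]

omit [T2Space X] [CompactSpace X] in
/-- The column function on `ℝ³` is `C²`. [folklore] -/
theorem contDiff_colFn3 : ContDiff ℝ 2 (TubeColumn.colFn3 𝔔.w 𝔔.ρ 𝔔.R₀ 𝔉.kg 𝔉.εT 𝔉.κT 𝔉.η₂ (T.c - B.a)) :=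
  TubeColumn.contDiff_colFn3 (𝔔.w_contDiff.of_le (by norm_cast)) (𝔔.ρ_contDiff.of_le (by norm_cast))
    (𝔔.R₀_contDiff.of_le (by norm_cast))

omit [T2Space X] [CompactSpace X] in
/-- `G₁` is `C²`. [folklore] -/
theorem contDiff_colG : ContDiff ℝ 2 𝔔.colG :=
  contDiff_const.sub (contDiff_const.mul (RadialThickening.contDiff_rthicken 𝔔.contDiff_colFn3))

omit [T2Space X] [CompactSpace X] in
/-- `dG₁ = -C dG`. [folklore] -/
theorem fderiv_colG (u : EuclideanSpace ℝ (Fin 4)) :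
    fderiv ℝ 𝔔.colG u = -𝔔.C • fderiv ℝ (TubeColumn.colFn 𝔔.w 𝔔.ρ 𝔔.R₀ 𝔉.kg 𝔉.εT 𝔉.κT 𝔉.η₂ (T.c - B.a)) u := by
  have hd : DifferentiableAt ℝ (TubeColumn.colFn 𝔔.w 𝔔.ρ 𝔔.R₀ 𝔉.kg 𝔉.εT 𝔉.κT 𝔉.η₂ (T.c - B.a)) u :=
    (RadialThickening.contDiff_rthicken 𝔔.contDiff_colFn3).differentiable (by norm_num) u
  unfold colG
  rw [fderiv_const_sub, fderiv_const_mul hd, neg_smul]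

/-! ### The model hypotheses on the column -/

omit [T2Space X] [CompactSpace X] in
/-- `T₀ = c - a = η₂ + ν² < 2η₂`. [folklore] -/
theorem _root_.Literature.Topology.FourManifolds.BiCollar.TriData.TubeFrame.sub_lt_two_mul (𝔉 : T.TubeFrame ι) :
    T.c - B.a < 2 * 𝔉.η₂ := by
  rw [𝔉.c_eq]; nlinarith [𝔉.two_nu_sq_le, 𝔉.ν_pos]

omit [T2Space X] [CompactSpace X] in
/-- The face factor of the column: `(η₂ - a)(c - a - η₂ + a) R₀(a) = (η₂ - a)(ν² + a) R₀(a)`. [folklore] -/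
theorem col𝒜_eq : (fun a => (𝔉.η₂ - a) * (T.c - B.a - 𝔉.η₂ + a) * 𝔔.R₀ a) =
    fun a => (𝔉.η₂ - a) * (𝔉.ν ^ 2 + a) * 𝔔.R₀ a := by
  funext a; rw [𝔉.c_eq]; ring

omit [T2Space X] [CompactSpace X] in
/-- `ĝ ≤ 1`. [folklore] -/
theorem gmod_le_one (x : EuclideanSpace ℝ (Fin 2)) : ChartZone.gmod 𝔉.εT 𝔔.ρ x ≤ 1 := by
  rw [ChartZone.gmod_apply]
  have : 0 ≤ 𝔉.εT * (x 0 ^ 2 * 𝔔.ρ (TubeModel.nsq x)) := mul_nonneg 𝔉.εT_nonneg (mul_nonneg (sq_nonneg _) (𝔔.ρ_nonneg _))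
  linarith

omit [T2Space X] [CompactSpace X] in
/-- **On the column, `k_g 𝒯̂(coord_j) < b - δ_w`**, so that `w' < 0` there: `𝒯̂ ≤ 1 + (κ_T/η₂) P_j`,
`P_j < P₀`, `k_g(1 + (κ_T/η₂)P₀) ≤ b - m₀` and `δ_w < m₀`. [cite: GayKirby2016, §4, Lemma 14] -/
theorem kg_tubeHat_lt_of_mem_col {y : X} (hy : y ∈ 𝔔.col j) :
    𝔉.kg * TubeModel.tubeHat 𝔉.εT 𝔉.κT 𝔉.η₂ 𝔔.ρ ((𝔉.boxes.box j).coord y) < B.b - 𝔔.δw := by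
  have hP := 𝔔.P_lt_of_mem_col hy
  have hT : TubeModel.tubeHat 𝔉.εT 𝔉.κT 𝔉.η₂ 𝔔.ρ ((𝔉.boxes.box j).coord y) ≤ 1 + 𝔉.κT / 𝔉.η₂ * 𝔉.boxes.P j y := by
    rw [TubeModel.tubeHat_apply, HandleBoxes.P_def, 𝔉.boxes.A_eq_nsq, 𝔉.boxes.B_eq_bsq]
    have := 𝔔.gmod_le_one (RadialThickening.proj ((𝔉.boxes.box j).coord y))
    linarith
  have hκ : 0 ≤ 𝔉.κT / 𝔉.η₂ := div_nonneg 𝔉.κT_pos.le 𝔉.η₂_pos.le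
  have h1 : 𝔉.kg * TubeModel.tubeHat 𝔉.εT 𝔉.κT 𝔉.η₂ 𝔔.ρ ((𝔉.boxes.box j).coord y) ≤ 𝔉.kg * (1 + 𝔉.κT / 𝔉.η₂ * 𝔉.P₀) := by
    apply mul_le_mul_of_nonneg_left _ 𝔉.kg_pos.le
    have := mul_le_mul_of_nonneg_left hP.le hκ
    linarith
  linarith [𝔔.tube_top, 𝔔.δw_lt_m₀]

omit [T2Space X] [CompactSpace X] in
/-- **The hypotheses of the model computation hold on the column** at every point:
`0 < s < T₀`, `w > 0 > w'` at `k_g 𝒯̂`, `R₀ > 0`, the radial inequality, `𝒜 > 0`, `ρ ≥ 0 ≥ ρ'`,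
`w' ≤ 0`, and the design inequality. [cite: GayKirby2016, §4, Lemma 14] -/
theorem eq_zero_of_fderiv_colFn_eq_zero_of_mem_col {y : X} (hy : y ∈ 𝔔.col j)
    (h0 : fderiv ℝ (TubeColumn.colFn 𝔔.w 𝔔.ρ 𝔔.R₀ 𝔉.kg 𝔉.εT 𝔉.κT 𝔉.η₂ (T.c - B.a)) ((𝔉.boxes.box j).coord y) = 0) :
    (𝔉.boxes.box j).coord y = 0 := by
  set u := (𝔉.boxes.box j).coord y with hu
  have hs : TubeSaturation.sM 𝔉.η₂ u = B.f y - B.a := (𝔉.boxes.sub_eq_sM hy.1).symm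
  have hA : TubeModel.nsq (RadialThickening.proj u) = 𝔉.boxes.A j y := (𝔉.boxes.A_eq_nsq j y).symm
  have hA0 : 0 ≤ 𝔉.boxes.A j y := 𝔉.boxes.A_nonneg j y
  have hA2 : 𝔉.boxes.A j y < 2 * 𝔔.aR := hy.2.1
  have hsδ := 𝔔.lt_sFun_of_mem_col hy
  have hsdef : B.sFun y = B.f y - B.a := rfl
  have ht := 𝔔.kg_tubeHat_lt_of_mem_col hy
  have hwd := 𝔔.w_contDiff.differentiable (by simp)
  have hρd := 𝔔.ρ_contDiff.differentiable (by simp)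
  have hRd := 𝔔.R₀_contDiff.differentiable (by simp)
  have hW' : deriv 𝔔.w (𝔉.kg * TubeModel.tubeHat 𝔉.εT 𝔉.κT 𝔉.η₂ 𝔔.ρ u) < 0 := 𝔔.w_deriv_neg _ ht
  refine TubeColumn.eq_zero_of_fderiv_colFn_eq_zero hwd hρd hRd ?_ ?_ 𝔉.sub_lt_two_mul (𝔔.w_pos _) hW' (𝔔.R₀_pos _)
    𝔉.kg_pos (div_pos 𝔉.κT_pos 𝔉.η₂_pos) 𝔉.εT_nonneg ?_ ?_ (𝔔.ρ_nonneg _) (𝔔.ρ_deriv_nonpos _)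
    (𝔔.w_deriv_nonpos _) ?_ h0
  · rw [hs]; linarith [B.U.δ_pos]
  · rw [hs]; linarith [hy.2.2.2]
  · -- the radial inequality
    rw [hA]
    have hrad := 𝔔.radial (𝔉.boxes.A j y) (𝔉.kg * TubeModel.tubeHat 𝔉.εT 𝔉.κT 𝔉.η₂ 𝔔.ρ u) hA0 hA2
    rw [abs_of_nonpos (𝔔.w_deriv_nonpos _)] at hrad
    have hx0 : u 0 ^ 2 ≤ 𝔉.boxes.A j y := by
      rw [← hA, TubeModel.nsq_apply, RadialThickening.proj_apply_zero, RadialThickening.proj_apply_one]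
      nlinarith [sq_nonneg (u 1)]
    have hR' : 0 ≤ -deriv 𝔔.R₀ (𝔉.boxes.A j y) := by linarith [𝔔.R₀_deriv_nonpos (𝔉.boxes.A j y)]
    have hW'0 : 0 ≤ -deriv 𝔔.w (𝔉.kg * TubeModel.tubeHat 𝔉.εT 𝔉.κT 𝔉.η₂ 𝔔.ρ u) := by linarith
    have hRHS : 0 ≤ 𝔉.boxes.A j y * 𝔔.w (𝔉.kg * TubeModel.tubeHat 𝔉.εT 𝔉.κT 𝔉.η₂ 𝔔.ρ u) * -deriv 𝔔.R₀ (𝔉.boxes.A j y) +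
        𝔉.boxes.A j y ^ 2 * (𝔉.κT / 𝔉.η₂) * -deriv 𝔔.w (𝔉.kg * TubeModel.tubeHat 𝔉.εT 𝔉.κT 𝔉.η₂ 𝔔.ρ u) * 𝔉.kg *
          𝔔.R₀ (𝔉.boxes.A j y) := by
      have := 𝔔.w_pos (𝔉.kg * TubeModel.tubeHat 𝔉.εT 𝔉.κT 𝔉.η₂ 𝔔.ρ u)
      have := 𝔔.R₀_pos (𝔉.boxes.A j y)
      have := div_pos 𝔉.κT_pos 𝔉.η₂_pos
      have := 𝔉.kg_pos
      positivity
    set E := 𝔔.ρ (𝔉.boxes.A j y) + 𝔉.boxes.A j y * deriv 𝔔.ρ (𝔉.boxes.A j y) with hE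
    set K := -deriv 𝔔.w (𝔉.kg * TubeModel.tubeHat 𝔉.εT 𝔉.κT 𝔉.η₂ 𝔔.ρ u) * 𝔉.kg * 𝔔.R₀ (𝔉.boxes.A j y) with hK
    have hK0 : 0 ≤ K := by have := 𝔔.R₀_pos (𝔉.boxes.A j y); have := 𝔉.kg_pos; positivity
    have hlhs : 𝔉.εT * u 0 ^ 2 * E * -deriv 𝔔.w (𝔉.kg * TubeModel.tubeHat 𝔉.εT 𝔉.κT 𝔉.η₂ 𝔔.ρ u) * 𝔉.kg *
        𝔔.R₀ (𝔉.boxes.A j y) = 𝔉.εT * u 0 ^ 2 * E * K := by rw [hK]; ring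
    have hfield : 𝔉.εT * 𝔉.boxes.A j y * E * -deriv 𝔔.w (𝔉.kg * TubeModel.tubeHat 𝔉.εT 𝔉.κT 𝔉.η₂ 𝔔.ρ u) * 𝔉.kg *
        𝔔.R₀ (𝔉.boxes.A j y) = 𝔉.εT * 𝔉.boxes.A j y * E * K := by rw [hK]; ring
    rw [hlhs]
    rw [hfield] at hrad
    rcases le_or_gt 0 E with hE0 | hE0
    · have h1 : 𝔉.εT * u 0 ^ 2 * E * K ≤ 𝔉.εT * 𝔉.boxes.A j y * E * K := by
        have : 0 ≤ 𝔉.εT * E * K := mul_nonneg (mul_nonneg 𝔉.εT_nonneg hE0) hK0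
        nlinarith
      exact h1.trans hrad
    · have h1 : 𝔉.εT * u 0 ^ 2 * E * K ≤ 0 := by
        have : 0 ≤ 𝔉.εT * u 0 ^ 2 * K := mul_nonneg (mul_nonneg 𝔉.εT_nonneg (sq_nonneg _)) hK0
        nlinarith
      exact h1.trans hRHS
  · -- `𝒜 > 0`
    rw [hA]
    have h1 : 0 < 𝔉.η₂ - 𝔉.boxes.A j y := by linarith [𝔔.two_aR_le]
    have h2 : 0 < T.c - B.a - 𝔉.η₂ + 𝔉.boxes.A j y := by rw [𝔉.c_eq]; nlinarith [𝔉.ν_pos]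
    exact mul_pos (mul_pos h1 h2) (𝔔.R₀_pos _)
  · -- the design inequality
    rw [hA, 𝔔.col𝒜_eq]
    exact 𝔔.design _ _ hA0 hA2

/-! ### The critical points of `ψ₂` on the columns -/

omit [T2Space X] [CompactSpace X] in
/-- `coord_j y = 0` forces `y = c_j` (injectivity of the chart on its source). [folklore] -/
theorem _root_.Literature.Topology.FourManifolds.BiCollar.TriData.TubeFrame.eq_cpt_of_coord_eq_zero (𝔉 : T.TubeFrame ι)
    {j : ι} {y : X} (hy : y ∈ (𝔉.boxes.box j).chart.source) (h0 : (𝔉.boxes.box j).coord y = 0) :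
    y = 𝔉.boxes.cpt j := by
  have h1 : (𝔉.boxes.box j).chart.extend (𝓡 4) y = (𝔉.boxes.box j).chart.extend (𝓡 4) (𝔉.boxes.cpt j) := by
    have : (𝔉.boxes.box j).coord y = (𝔉.boxes.box j).chart.extend (𝓡 4) y -
        (𝔉.boxes.box j).chart.extend (𝓡 4) (𝔉.boxes.cpt j) := rfl
    rw [this] at h0
    exact sub_eq_zero.1 h0
  have hinj := ((𝔉.boxes.box j).chart.extend (𝓡 4)).injOn
  rw [OpenPartialHomeomorph.extend_source] at hinj
  exact hinj hy (𝔉.boxes.box j).mem_source h1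

/-- **The only critical point of `ψ₂` on a handle column is the centre.** [cite: GayKirby2016, §4, Lemma 14] -/
theorem eq_cpt_of_isMCriticalPt_psiTwo_of_mem_col {y : X} (hy : y ∈ 𝔔.col j) (hc : IsMCriticalPt (𝓡 4) 𝔔.psiTwo y) :
    y = 𝔉.boxes.cpt j := by
  have hev := 𝔔.psiTwo_eventuallyEq_of_mem_col hy
  have hc' : IsMCriticalPt (𝓡 4) (𝔔.colG ∘ (𝔉.boxes.box j).coord) y :=
    (isMCriticalPt_congr_of_eventuallyEq hev).1 hc
  have hGd : DifferentiableAt ℝ 𝔔.colG ((𝔉.boxes.box j).coord y) := 𝔔.contDiff_colG.differentiable (by norm_num) _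
  have h0 := ((𝔉.boxes.box j).isMCriticalPt_comp_coord_iff hy.1 hGd).1 hc'
  rw [𝔔.fderiv_colG] at h0
  have h0' : fderiv ℝ (TubeColumn.colFn 𝔔.w 𝔔.ρ 𝔔.R₀ 𝔉.kg 𝔉.εT 𝔉.κT 𝔉.η₂ (T.c - B.a)) ((𝔉.boxes.box j).coord y) = 0 := by
    rcases smul_eq_zero.1 h0 with h | h
    · exact absurd h (neg_ne_zero.2 𝔔.C_pos.ne')
    · exact h
  exact 𝔉.eq_cpt_of_coord_eq_zero hy.1 (𝔔.eq_zero_of_fderiv_colFn_eq_zero_of_mem_col hy h0')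

/-! ### The centre -/

omit [T2Space X] [CompactSpace X] in
/-- The centre lies in its column. [folklore] -/
theorem cpt_mem_col (j : ι) : 𝔉.boxes.cpt j ∈ 𝔔.col j := by
  refine ⟨(𝔉.boxes.box j).mem_source, ?_, ?_, ?_⟩
  · rw [HandleBoxes.A_def, MilnorBox.coord_self, sqSumLT]; simp; linarith [𝔔.aR_pos]
  · rw [𝔉.boxes.apply_cpt]; linarith [𝔉.η₂_pos, B.U.δ_pos]
  · rw [𝔉.boxes.apply_cpt, 𝔉.c_eq]; nlinarith [𝔉.ν_pos]

omit [T2Space X] [CompactSpace X] in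
/-- **The centre of a box is a critical point of `f`** (`f = f(c_j) + Q₂(coord_j)` near it). [cite: MilnorHCobordism1965, Def. 3.1] -/
theorem _root_.Literature.Topology.FourManifolds.BiCollar.TriData.TubeFrame.isMCriticalPt_f_cpt (𝔉 : T.TubeFrame ι) (j : ι) :
    IsMCriticalPt (𝓡 4) B.f (𝔉.boxes.cpt j) := by
  have hsrc := (𝔉.boxes.box j).mem_source
  set G : EuclideanSpace ℝ (Fin 4) → ℝ := fun u => B.f (𝔉.boxes.cpt j) + milnorQuadratic 2 u with hG
  have hev : B.f =ᶠ[𝓝 (𝔉.boxes.cpt j)] G ∘ (𝔉.boxes.box j).coord := by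
    filter_upwards [(𝔉.boxes.box j).chart.open_source.mem_nhds hsrc] with y hy
    simp only [comp_apply, hG]
    rw [(𝔉.boxes.box j).apply_eq y hy, 𝔉.boxes.k_eq j]
    rfl
  have hGd : DifferentiableAt ℝ G ((𝔉.boxes.box j).coord (𝔉.boxes.cpt j)) :=
    (differentiableAt_const _).add (hasFDerivAt_milnorQuadratic 2 _).differentiableAt
  rw [isMCriticalPt_congr_of_eventuallyEq hev, (𝔉.boxes.box j).isMCriticalPt_comp_coord_iff hsrc hGd, MilnorBox.coord_self]
  show fderiv ℝ G 0 = 0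
  rw [hG, fderiv_const_add, (hasFDerivAt_milnorQuadratic 2 (0 : EuclideanSpace ℝ (Fin 4))).fderiv]
  simp

/-- The centre does not hit the level (it is a critical point of `f`). [folklore] -/
theorem _root_.Literature.Topology.FourManifolds.BiCollar.TriData.TubeFrame.not_hit_cpt (𝔉 : T.TubeFrame ι) (j : ι) :
    ¬ B.Hit (𝔉.boxes.cpt j) := fun hh =>
  T.Fr.not_isMCriticalPt_of_hit hh (𝔉.isMCriticalPt_f_cpt j)

include 𝔔 in
/-- **The centre of each box lies in `X₂`** (a sheet point off `X₁`). [cite: GayKirby2016, §4, Lemma 14] -/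
theorem cpt_mem_X₂ (j : ι) : 𝔉.boxes.cpt j ∈ T.X₂ := by
  have hcol := 𝔔.cpt_mem_col j
  refine T.mem_X₂_of_not_hit (fun h1 => ?_) hcol.2.2.2.le (𝔉.not_hit_cpt j)
  have : T.D.F₁ (𝔉.boxes.cpt j) ≤ 0 := h1
  linarith [𝔔.F₁_pos_of_mem_col hcol]

include 𝔔 in
/-- The centre is off the surface, off the bevel face and off `{M̃ = 0}`. [folklore] -/
theorem cpt_interior (j : ι) :
    𝔉.boxes.cpt j ∉ B.surface ∧ T.D.F₁ (𝔉.boxes.cpt j) ≠ 0 ∧ T.Mt (𝔉.boxes.cpt j) ≠ 0 := by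
  have hcol := 𝔔.cpt_mem_col j
  have hF := 𝔔.F₁_pos_of_mem_col hcol
  exact ⟨fun hs => hF.ne' (T.D.F₁_eq_zero_of_mem_surface hs), hF.ne', (𝔔.Mt_neg_of_mem_col hcol).ne⟩

/-- **The centre of each `2`-handle is a nondegenerate critical point of `ψ₂` of index `0`.** [cite: GayKirby2016, §4, Lemma 14] [cite: Milnor1963, §2] -/
theorem morseData_psiTwo_cpt (j : ι) :
    IsMCriticalPt (𝓡 4) 𝔔.psiTwo (𝔉.boxes.cpt j) ∧
      (mhessian (𝓡 4) 𝔔.psiTwo (𝔉.boxes.cpt j)).Nondegenerate ∧ morseIndex (𝓡 4) 𝔔.psiTwo (𝔉.boxes.cpt j) = 0 := by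
  have hcol := 𝔔.cpt_mem_col j
  have hsrc := (𝔉.boxes.box j).mem_source
  have hev := 𝔔.psiTwo_eventuallyEq_of_mem_col hcol
  have hev0 : 𝔔.psiTwo =ᶠ[𝓝 (𝔉.boxes.cpt j)] fun y => (𝔔.colG ∘ (𝔉.boxes.box j).coord) y + 0 :=
    hev.trans (Eventually.of_forall fun y => (add_zero _).symm)
  -- the model data at `0 = coord c_j`
  have h0 : (𝔉.boxes.box j).coord (𝔉.boxes.cpt j) = 0 := MilnorBox.coord_self _
  have hmodel := TubeColumn.morseData_one_sub_colFn_zero (κ := 𝔉.κT) (𝔔.w_contDiff.of_le (by norm_cast))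
    (𝔔.ρ_contDiff.of_le (by norm_cast)) (𝔔.R₀_contDiff.of_le (by norm_cast)) 𝔔.C_pos 𝔉.sub_lt_two_mul
    (𝔔.w_pos 𝔉.kg) (𝔔.R₀_pos 0) (by
      have h2 : 0 < T.c - B.a - 𝔉.η₂ := by rw [𝔉.c_eq]; nlinarith [𝔉.ν_pos]
      exact mul_pos (mul_pos 𝔉.η₂_pos h2) (𝔔.R₀_pos 0))
    (𝔔.ρ_nonneg 0) (𝔔.w_deriv_nonpos _) (mul_nonneg 𝔉.kg_pos.le 𝔉.εT_nonneg)
    (by rw [𝔔.col𝒜_eq]; exact 𝔔.design 0 _ le_rfl (by linarith [𝔔.aR_pos]))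
  change IsMCriticalPt (𝓡 4) 𝔔.colG 0 ∧ (mhessian (𝓡 4) 𝔔.colG 0).Nondegenerate ∧ morseIndex (𝓡 4) 𝔔.colG 0 = 0 at hmodel
  obtain ⟨hcritG, hndG, hidxG⟩ := hmodel
  -- transfer through Milnor's chart
  have hGd : DifferentiableAt ℝ 𝔔.colG ((𝔉.boxes.box j).coord (𝔉.boxes.cpt j)) :=
    𝔔.contDiff_colG.differentiable (by norm_num) _
  have hcrit' : IsMCriticalPt (𝓡 4) (𝔔.colG ∘ (𝔉.boxes.box j).coord) (𝔉.boxes.cpt j) := by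
    refine ((𝔉.boxes.box j).isMCriticalPt_comp_coord_iff hsrc hGd).2 ?_
    rw [h0]; exact (MorseBirth.isMCriticalPt_iff_fderiv _ _).1 hcritG
  have htr := (𝔉.boxes.box j).morseData_comp_coord hsrc (𝔔.contDiff_colG.contDiffAt) hcrit'
  rw [h0] at htr
  refine ⟨(isMCriticalPt_congr_of_eventuallyEq hev).2 hcrit', ?_, ?_⟩
  · rw [mhessian_congr_of_eventuallyEq_add_const hev0]; exact htr.1.2 hndG
  · rw [morseIndex_congr_of_eventuallyEq hev, htr.2, hidxG]

end MidParams

end TubeFrame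

end TriData

end BiCollar

end Literature.Topology.FourManifolds

end
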